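import Literature.NumberTheory.Automorphic.HenniartAutomorphicInduction
import Literature.NumberTheory.Automorphic.BaseChangeInductionAlong
import Literature.NumberTheory.Automorphic.ArchParameterUnique
import HarnessLib

/-!
# Henniart's global automorphic induction (archimedean components): proved reductions

Topic `NumberTheory/Automorphic`; sibling proof file (theorems only: no definition, no named fact)
of `HenniartAutomorphicInduction`, whose named fact
`Henniart2012_infinityType_of_automorphicInduction` (Henniart 2012, §1.10, Thm. 3 (i), Thm. 4,
Thm. 5 and the closing Remarque of §3.7: the archimedean components of the automorphic induction
`τ^{L/K}` along a cyclic extension, read on infinity types) is NOT discharged here — its content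
is the twisted trace formula of Arthur–Clozel (Ch. 2–3), Jacquet–Shalika rigidity for isobaric
representations and the local archimedean theory [Henniart 2010], none of which the datum model of
`AutomorphicRepsGL` has yet (no isobaric sums, no archimedean local components, no automorphic
induction / base change fact with an archimedean clause for non-cuspidal lifts). What is proved:

* `HeightOneSpectrum.under_eq_iff_asIdeal` — `w.under (𝓞 K) = v ↔ w.asIdeal ∩ 𝓞 K = v.asIdeal`
  (Mathlib's two spellings of "`w ∣ v`").
* `eventually_satakeRelation_iff_isAutomorphicInductionAlong` — **the hypothesis of the named
  fact is literally Arthur–Clozel's Def. 6.1** as rendered by the tree: Henniart's defining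
  condition (1.1) at the finite places (the a.e. Satake relation
  `∏_{a ∈ α_P(v)} (X - a) = ∏_{w ∣ v} ∏_{b ∈ β_π(w)} (X^{f(w|v)} - b)`, written in
  `HenniartAutomorphicInduction` with `HeightOneSpectrum.under`) is equivalent to
  `IsAutomorphicInductionAlong π P` of `BaseChangeInductionAlong` (written with `Ideal.under`, in
  the conditional form; the equivalence of the two readings of Def. 6.1 is
  `isAutomorphicInductionAlong_iff_eventually_exists`, i.e. Flath's theorems
  `hasSatakeParamAt_cofinite_holds` / `hasSatakeParamAt_unique_holds`). Hence everything proved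
  about `IsAutomorphicInductionAlong` (induction in stages `.trans` — Henniart's reduction of
  Thm. 3 to prime degree —, `.rank_eq`, `.eventually_satakePolynomial_eq_iff`, and the existence
  fact `automorphicInduction_cyclic`, Arthur–Clozel Thm. 6.2) applies to the hypothesis of
  Henniart's statement, and conversely.
* `Henniart2012_infinityType_of_automorphicInduction_iff_along` — the named fact restated with
  `IsAutomorphicInductionAlong π.1 P.1` as hypothesis.
* `rank_eq_of_eventually_satakeRelation` — the relation forces the rank: `N = n [L : K]`
  (`IsAutomorphicInductionAlong.rank_eq`), so the typing `GL_{dn}` of the fact loses nothing.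
* `card_filter_comp_algebraMap_eq'`, `card_sum_map_a_eq` — bookkeeping check of the conclusion:
  `σ : K →+* ℂ` has exactly `d = [L : K]` extensions `σ' : L →+* ℂ` (`AlgHom.card`), so both
  sides of `(T_P σ).map a = ∑_{σ' ∣ σ} (T_π σ').map a` are multisets of `d n` numbers for
  well-formed types (the parameter of `P_v` restricted to `ℂ^× ⊆ W_{K_v}` has `dn` exponents).
* `map_a_eq_sum_iff_of_hasInfinityType` — **the identity is a property of `(P, π)`**, not of the
  chosen infinity types: infinity types are not unique, but their `a`-multisets are
  (`AutomorphicRepData.HasInfinityType.map_a_eq` of `ArchParameterUnique`, i.e. uniqueness of the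
  Lie algebra action on `W / W'` and Harish-Chandra's theorem, proved in the tree).
* `Henniart2012_infinityType_of_automorphicInduction_iff_exists` — hence "for ALL infinity types"
  (as vendored) ⇔ "for SOME pair of infinity types, when any exist": the form a proof produces.
* `Henniart2012_infinityType_of_automorphicInduction.archParameter` — the fact read on the
  (unique) archimedean Harish-Chandra parameters `χ_P`, `χ_π`: `χ_P σ = ∑_{σ' ∣ σ} χ_π σ'`, the
  statement closest to Henniart's "`π_v` est l'induite automorphe locale de `τ_v`" at `v ∣ ∞`
  (Thm. 5, Remarque §3.7) on the data the tree has.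
* `exists_sum_filter_comp_eq_add_of_finrank_eq_two`, `InfinityType.not_isRegular_of_map_a_eq_add_self`
  — generic lemmas for the quadratic case (two extensions `σ₁ ≠ σ₂`; a doubled multiset of
  exponents is not regular), the shape in which route `SelfDefeatingInduction` consumes the fact.

## References

* G. Henniart, *Induction automorphe globale pour les corps de nombres*, Bull. Soc. Math. France
  140 (2012) 1–17: §1.10 (definition by (1.1)), §2.1 (rigidity), Thm. 3, Thm. 5, Remarque §3.7.
  [Henniart2012]
* J. Arthur, L. Clozel, Ann. of Math. Stud. 120 (1989), Ch. 3, Def. 6.1, Thm. 6.2, (6.1)–(6.2).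
  [ArthurClozelAMS120]
-/

noncomputable section

open scoped NumberField Polynomial Classical
open NumberField IsDedekindDomain Polynomial Filter Finset Literature.NumberTheory.Automorphic

namespace Literature.NumberTheory.Automorphic

section Places

variable {K : Type} [Field K] [NumberField K] {L : Type} [Field L] [NumberField L] [Algebra K L]

omit [NumberField K] [NumberField L] in
/-- The two Mathlib spellings of "`w` lies over `v`" for finite places agree:
`w.under (𝓞 K) = v ↔ w.asIdeal.under (𝓞 K) = v.asIdeal` (`HeightOneSpectrum.under` is the
bundled pull-back). [folklore] -/
theorem HeightOneSpectrum.under_eq_iff_asIdeal (w : HeightOneSpectrum (𝓞 L))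
    (v : HeightOneSpectrum (𝓞 K)) :
    w.under (𝓞 K) = v ↔ w.asIdeal.under (𝓞 K) = v.asIdeal := by
  rw [HeightOneSpectrum.ext_iff, HeightOneSpectrum.under_asIdeal]

omit [NumberField K] [NumberField L] in
/-- The fibre `{w ∣ v}` in the two spellings is the same set. [folklore] -/
theorem HeightOneSpectrum.setOf_under_eq (v : HeightOneSpectrum (𝓞 K)) :
    {w : HeightOneSpectrum (𝓞 L) | w.under (𝓞 K) = v} =
      {w : HeightOneSpectrum (𝓞 L) | w.asIdeal.under (𝓞 K) = v.asIdeal} :=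
  Set.ext fun w => HeightOneSpectrum.under_eq_iff_asIdeal w v

end Places

section Bridge

variable {K : Type} [Field K] [NumberField K] {L : Type} [Field L] [NumberField L] [Algebra K L]
  {N n : ℕ} {hK : isCompact_glFiniteIntegralLevel N K} {hL : isCompact_glFiniteIntegralLevel n L}
  (P : AutomorphicRepData (AutomorphyDatum.gl N K hK))
  (π : AutomorphicRepData (AutomorphyDatum.gl n L hL))

/-- **Henniart's defining condition (1.1) at the finite places = Arthur–Clozel's Def. 6.1.** The
hypothesis of `Henniart2012_infinityType_of_automorphicInduction` — for almost every finite place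
`v` of `K` there are Satake parameters `α` of `P` at `v` and `β_w` of `π` at all `w ∣ v` with
`∏_{a ∈ α} (X - a) = ∏_{w ∣ v} ∏_{b ∈ β_w} (X^{f(w|v)} - b)` — is equivalent to the tree's
`IsAutomorphicInductionAlong π P` (`BaseChangeInductionAlong`; the two readings of Def. 6.1 agree
by `isAutomorphicInductionAlong_iff_eventually_exists`, i.e. by Flath's theorems).
Henniart 2012, §1.10 with (1.1); Arthur–Clozel 1989, Ch. 3, Def. 6.1.
[cite: Henniart2012, §1.10] [cite: ArthurClozelAMS120, Ch. 3 Def. 6.1] -/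
theorem eventually_satakeRelation_iff_isAutomorphicInductionAlong :
    (∀ᶠ v : HeightOneSpectrum (𝓞 K) in cofinite,
      ∃ (α : Multiset ℂ) (β : HeightOneSpectrum (𝓞 L) → Multiset ℂ),
        P.HasSatakeParamAt v α ∧
        (∀ w : HeightOneSpectrum (𝓞 L), w.under (𝓞 K) = v → π.HasSatakeParamAt w (β w)) ∧
        satakePolynomial α =
          ∏ᶠ w ∈ {w : HeightOneSpectrum (𝓞 L) | w.under (𝓞 K) = v},
            (satakePolynomial (β w)).comp (X ^ w.asIdeal.inertiaDeg (𝓞 K))) ↔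
      IsAutomorphicInductionAlong π P := by
  rw [isAutomorphicInductionAlong_iff_eventually_exists]
  simp only [HeightOneSpectrum.under_eq_iff_asIdeal, inducedSatakePolynomial_def]
  constructor
  · intro h
    filter_upwards [h] with v hv
    obtain ⟨α, β, hα, hβ, hrel⟩ := hv
    exact ⟨β, hβ, α, hα, hrel⟩
  · intro h
    filter_upwards [h] with v hv
    obtain ⟨β, hβ, α, hα, hrel⟩ := hv
    exact ⟨α, β, hα, hβ, hrel⟩

/-- **The relation forces the rank** (`IsAutomorphicInductionAlong.rank_eq`): if `P` on
`GL_N(𝔸_K)` and `π` on `GL_n(𝔸_L)` satisfy Henniart's (1.1) at almost all finite places, then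
`N = n [L : K]` — so typing `P` on `GL_{dn}`, `d = [L : K]`, in the named fact is no restriction.
[cite: ArthurClozelAMS120, Ch. 3 Def. 6.1] -/
theorem rank_eq_of_eventually_satakeRelation
    (h : ∀ᶠ v : HeightOneSpectrum (𝓞 K) in cofinite,
      ∃ (α : Multiset ℂ) (β : HeightOneSpectrum (𝓞 L) → Multiset ℂ),
        P.HasSatakeParamAt v α ∧
        (∀ w : HeightOneSpectrum (𝓞 L), w.under (𝓞 K) = v → π.HasSatakeParamAt w (β w)) ∧
        satakePolynomial α =
          ∏ᶠ w ∈ {w : HeightOneSpectrum (𝓞 L) | w.under (𝓞 K) = v},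
            (satakePolynomial (β w)).comp (X ^ w.asIdeal.inertiaDeg (𝓞 K))) :
    N = n * Module.finrank K L :=
  ((eventually_satakeRelation_iff_isAutomorphicInductionAlong P π).mp h).rank_eq

end Bridge

/-! ### The named fact in the vocabulary of `BaseChangeInductionAlong` -/

/-- `Henniart2012_infinityType_of_automorphicInduction` with its hypothesis written as
`IsAutomorphicInductionAlong π.1 P.1` (Arthur–Clozel's Def. 6.1 as rendered by the tree), to which
induction in stages (`IsAutomorphicInductionAlong.trans`) and `automorphicInduction_cyclic` apply
directly. [cite: Henniart2012, §1.10, Thm. 3 (i), Thm. 4, Thm. 5 and Remarque §3.7] -/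
theorem Henniart2012_infinityType_of_automorphicInduction_iff_along :
    Henniart2012_infinityType_of_automorphicInduction ↔
      ∀ (K L : Type) [Field K] [NumberField K] [Field L] [NumberField L] [Algebra K L]
        [IsGalois K L], IsCyclic (L ≃ₐ[K] L) →
        ∀ (n d : ℕ), 0 < n → Module.finrank K L = d →
        ∀ (hK : isCompact_glFiniteIntegralLevel (d * n) K)
          (hL : isCompact_glFiniteIntegralLevel n L)
          (P : CuspidalAutomorphicRepData (d * n) K hK) (π : CuspidalAutomorphicRepData n L hL),
          IsAutomorphicInductionAlong π.1 P.1 →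
          ∀ (TP : InfinityType K (d * n)) (Tπ : InfinityType L n),
            P.1.HasInfinityType TP → π.1.HasInfinityType Tπ →
            ∀ σ : K →+* ℂ,
              (TP σ).map ArchWeight.a =
                ∑ σ' ∈ Finset.univ.filter (fun σ' : L →+* ℂ => σ'.comp (algebraMap K L) = σ),
                  (Tπ σ').map ArchWeight.a := by
  refine forall_congr' fun K => forall_congr' fun L => forall_congr' fun _ =>
    forall_congr' fun _ => forall_congr' fun _ => forall_congr' fun _ => forall_congr' fun _ =>
    forall_congr' fun _ => forall_congr' fun _ => forall_congr' fun n => forall_congr' fun d =>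
    forall_congr' fun _ => forall_congr' fun _ => forall_congr' fun hK =>
    forall_congr' fun hL => forall_congr' fun P => forall_congr' fun π => ?_
  rw [eventually_satakeRelation_iff_isAutomorphicInductionAlong P.1 π.1]

/-! ### Bookkeeping: both sides of the conclusion have `d n` entries -/

section Card

variable {K : Type} [Field K] [NumberField K] {L : Type} [Field L] [NumberField L] [Algebra K L]

/-- Every complex embedding `σ` of `K` has exactly `[L : K]` extensions to `L` (the `K`-algebra
maps `L →ₐ[K] ℂ` for the `K`-algebra structure `σ` on `ℂ`; Mathlib `AlgHom.card`). A copy of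
`NumberField.card_filter_comp_algebraMap_eq` (`EllipticCurves/HeightsBaseChangeProofs`), not
imported here. [folklore] -/
theorem card_filter_comp_algebraMap_eq' (σ : K →+* ℂ) :
    #{σ' : L →+* ℂ | σ'.comp (algebraMap K L) = σ} = Module.finrank K L := by
  letI : Algebra K ℂ := σ.toAlgebra
  let e : {σ' : L →+* ℂ // σ'.comp (algebraMap K L) = σ} ≃ (L →ₐ[K] ℂ) :=
    { toFun := fun φ => { (φ.1 : L →+* ℂ) with commutes' := fun k => RingHom.congr_fun φ.2 k }
      invFun := fun g => ⟨g.toRingHom, RingHom.ext fun k => g.commutes k⟩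
      left_inv := fun φ => by ext; rfl
      right_inv := fun g => by ext; rfl }
  rw [← Fintype.card_subtype, Fintype.card_congr e, AlgHom.card K L ℂ]

/-- **Both sides of Henniart's identity are multisets of `d n` complex numbers**: for well-formed
infinity types `T_P` of rank `dn` over `K` and `T_π` of rank `n` over `L`, `d = [L : K]`, and any
`σ : K →+* ℂ`, `#(T_P σ).map a = d n = # ∑_{σ' ∣ σ} (T_π σ').map a`. (The parameter of `P_v`
restricted to `ℂ^× ⊆ W_{K_v}` has `dn` exponents; each of the `d` embeddings `σ' ∣ σ` contributes
the `n` exponents of `π` at `σ'`.) [cite: Henniart2012, Thm. 5 and Remarque §3.7] -/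
theorem card_sum_map_a_eq {n d : ℕ} (hd : Module.finrank K L = d) {TP : InfinityType K (d * n)}
    {Tπ : InfinityType L n} (hTP : TP.IsWellFormed) (hTπ : Tπ.IsWellFormed) (σ : K →+* ℂ) :
    Multiset.card ((TP σ).map ArchWeight.a) = d * n ∧
      Multiset.card (∑ σ' ∈ Finset.univ.filter (fun σ' : L →+* ℂ => σ'.comp (algebraMap K L) = σ),
        (Tπ σ').map ArchWeight.a) = d * n := by
  refine ⟨by rw [Multiset.card_map, hTP.1 σ], ?_⟩
  rw [Multiset.card_sum, Finset.sum_congr rfl fun σ' _ => by rw [Multiset.card_map, hTπ.1 σ'],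
    Finset.sum_const, smul_eq_mul, card_filter_comp_algebraMap_eq', hd]

end Card

/-! ### The conclusion does not depend on the chosen infinity types (Harish-Chandra) -/

section Invariance

variable {K : Type} [Field K] [NumberField K] {L : Type} [Field L] [NumberField L] [Algebra K L]
  {N n : ℕ} {hK : isCompact_glFiniteIntegralLevel N K} {hL : isCompact_glFiniteIntegralLevel n L}
  (P : AutomorphicRepData (AutomorphyDatum.gl N K hK))
  (π : AutomorphicRepData (AutomorphyDatum.gl n L hL))

/-- **Henniart's identity is a property of `(P, π)`, not of the chosen infinity types.** An
infinity type is not unique (the pairing `(a_i, b_i)` is not read), but the multisets of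
`z`-exponents at each embedding are (`AutomorphicRepData.HasInfinityType.map_a_eq`: uniqueness of
the Lie algebra action on `W / W'` and of Harish-Chandra parameters, proved in
`ArchParameterUnique` from Harish-Chandra's theorem); so the identity
`(T_P σ).map a = ∑_{σ' ∣ σ} (T_π σ').map a` holds for one pair of infinity types of `P`, `π` iff it
holds for every pair. Clozel 1990, §3.3. [cite: Clozel1990, §3.3] -/
theorem map_a_eq_sum_iff_of_hasInfinityType {TP TP' : InfinityType K N} {Tπ Tπ' : InfinityType L n}
    (hTP : P.HasInfinityType TP) (hTP' : P.HasInfinityType TP') (hTπ : π.HasInfinityType Tπ)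
    (hTπ' : π.HasInfinityType Tπ') (σ : K →+* ℂ) :
    ((TP σ).map ArchWeight.a =
        ∑ σ' ∈ Finset.univ.filter (fun σ' : L →+* ℂ => σ'.comp (algebraMap K L) = σ),
          (Tπ σ').map ArchWeight.a) ↔
      ((TP' σ).map ArchWeight.a =
        ∑ σ' ∈ Finset.univ.filter (fun σ' : L →+* ℂ => σ'.comp (algebraMap K L) = σ),
          (Tπ' σ').map ArchWeight.a) := by
  rw [AutomorphicRepData.HasInfinityType.map_a_eq P hTP hTP' σ,
    Finset.sum_congr rfl fun σ' _ => AutomorphicRepData.HasInfinityType.map_a_eq π hTπ hTπ' σ']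

end Invariance

/-- **"For all infinity types" = "for some infinity types".** The named fact is equivalent to: for
`P` automorphically induced from `π` (Def. 6.1 a.e.), if `P` and `π` have infinity types at all
(`AutomorphicRepData.exists_hasInfinityType`, Clozel 1990 §3.3), then SOME pair of infinity types
satisfies Henniart's identity at every `σ` — the form in which a proof constructs it (e.g. from
the archimedean components of `τ^{L/K}`, Henniart 2012 Thm. 5 and Remarque §3.7).
[cite: Henniart2012, §1.10, Thm. 3 (i), Thm. 4, Thm. 5 and Remarque §3.7] -/
theorem Henniart2012_infinityType_of_automorphicInduction_iff_exists :
    Henniart2012_infinityType_of_automorphicInduction ↔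
      ∀ (K L : Type) [Field K] [NumberField K] [Field L] [NumberField L] [Algebra K L]
        [IsGalois K L], IsCyclic (L ≃ₐ[K] L) →
        ∀ (n d : ℕ), 0 < n → Module.finrank K L = d →
        ∀ (hK : isCompact_glFiniteIntegralLevel (d * n) K)
          (hL : isCompact_glFiniteIntegralLevel n L)
          (P : CuspidalAutomorphicRepData (d * n) K hK) (π : CuspidalAutomorphicRepData n L hL),
          IsAutomorphicInductionAlong π.1 P.1 →
          P.1.exists_hasInfinityType → π.1.exists_hasInfinityType →
          ∃ (TP : InfinityType K (d * n)) (Tπ : InfinityType L n),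
            P.1.HasInfinityType TP ∧ π.1.HasInfinityType Tπ ∧
            ∀ σ : K →+* ℂ,
              (TP σ).map ArchWeight.a =
                ∑ σ' ∈ Finset.univ.filter (fun σ' : L →+* ℂ => σ'.comp (algebraMap K L) = σ),
                  (Tπ σ').map ArchWeight.a := by
  rw [Henniart2012_infinityType_of_automorphicInduction_iff_along]
  constructor
  · intro h K L _ _ _ _ _ _ hcyc n d hn hd hK hL P π hAI hP hπ
    obtain ⟨TP, hTP⟩ := hP
    obtain ⟨Tπ, hTπ⟩ := hπ
    exact ⟨TP, Tπ, hTP, hTπ, fun σ => h K L hcyc n d hn hd hK hL P π hAI TP Tπ hTP hTπ σ⟩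
  · intro h K L _ _ _ _ _ _ hcyc n d hn hd hK hL P π hAI TP Tπ hTP hTπ σ
    obtain ⟨TP₀, Tπ₀, hTP₀, hTπ₀, hid⟩ := h K L hcyc n d hn hd hK hL P π hAI ⟨TP, hTP⟩ ⟨Tπ, hTπ⟩
    exact (map_a_eq_sum_iff_of_hasInfinityType P.1 π.1 hTP hTP₀ hTπ hTπ₀ σ).mpr (hid σ)

/-- **Henniart's statement on archimedean (Harish-Chandra) parameters**, from the named fact: for
`P` cuspidal on `GL_{dn}(𝔸_K)` automorphically induced from `π` cuspidal on `GL_n(𝔸_L)`, `L/K`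
cyclic of degree `d`, both having infinity types, the archimedean parameter of `P` at `σ` is the
sum of the archimedean parameters of `π` at the `d` embeddings `σ' ∣ σ` — "the parameter of `P_v`
restricted to `W_{L_w} ⊇ ℂ^×` is `⊕_i` (parameter of `(π^{g^i})_w`)" (Henniart 2012, Thm. 5 and
Remarque §3.7, with Thm. 3 (i), Thm. 4 and Arthur–Clozel Ch. 1 §7), for the unique
(`AutomorphicRepData.hasArchParameter_unique`) parameters rather than for infinity types.
[cite: Henniart2012, Thm. 5 and Remarque §3.7] -/
theorem Henniart2012_infinityType_of_automorphicInduction.archParameter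
    (h : Henniart2012_infinityType_of_automorphicInduction)
    (K L : Type) [Field K] [NumberField K] [Field L] [NumberField L] [Algebra K L] [IsGalois K L]
    (hcyc : IsCyclic (L ≃ₐ[K] L)) (n d : ℕ) (hn : 0 < n) (hd : Module.finrank K L = d)
    (hK : isCompact_glFiniteIntegralLevel (d * n) K) (hL : isCompact_glFiniteIntegralLevel n L)
    (P : CuspidalAutomorphicRepData (d * n) K hK) (π : CuspidalAutomorphicRepData n L hL)
    (hAI : IsAutomorphicInductionAlong π.1 P.1)
    (hP : P.1.exists_hasInfinityType) (hπ : π.1.exists_hasInfinityType)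
    {χP : (K →+* ℂ) → Multiset ℂ} {χπ : (L →+* ℂ) → Multiset ℂ}
    (hχP : P.1.HasArchParameter χP) (hχπ : π.1.HasArchParameter χπ) (σ : K →+* ℂ) :
    χP σ = ∑ σ' ∈ Finset.univ.filter (fun σ' : L →+* ℂ => σ'.comp (algebraMap K L) = σ),
      χπ σ' := by
  obtain ⟨TP, hTP⟩ := hP
  obtain ⟨Tπ, hTπ⟩ := hπ
  obtain rfl := (AutomorphicRepData.HasInfinityType.hasArchParameter_iff P.1 hTP χP).mp hχP
  obtain rfl := (AutomorphicRepData.HasInfinityType.hasArchParameter_iff π.1 hTπ χπ).mp hχπ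
  exact Henniart2012_infinityType_of_automorphicInduction_iff_along.mp h K L hcyc n d hn hd hK hL
    P π hAI TP Tπ hTP hTπ σ

/-! ### Two generic lemmas for the quadratic case (the shape used by `RegularInductionForcesCM`) -/

section Quadratic

variable {K : Type} [Field K] [NumberField K] {L : Type} [Field L] [NumberField L] [Algebra K L]

/-- For a quadratic extension `L/K`, an embedding `σ : K →+* ℂ` has exactly two extensions
`σ₁ ≠ σ₂` to `L`, and a sum over the extensions of `σ` is `f σ₁ + f σ₂` (Henniart's identity then
reads `(T_P σ).map a = (T_π σ₁).map a + (T_π σ₂).map a`: at a place of `K` split in `L`,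
`P_v ≅ π_{w₁} × π_{w₂}`). [folklore] -/
theorem exists_sum_filter_comp_eq_add_of_finrank_eq_two {M : Type*} [AddCommMonoid M]
    (hd : Module.finrank K L = 2) (σ : K →+* ℂ) (f : (L →+* ℂ) → M) :
    ∃ σ₁ σ₂ : L →+* ℂ, σ₁ ≠ σ₂ ∧ σ₁.comp (algebraMap K L) = σ ∧ σ₂.comp (algebraMap K L) = σ ∧
      ∑ σ' ∈ Finset.univ.filter (fun σ' : L →+* ℂ => σ'.comp (algebraMap K L) = σ), f σ' =
        f σ₁ + f σ₂ := by
  have hcard : #{σ' : L →+* ℂ | σ'.comp (algebraMap K L) = σ} = 2 := by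
    rw [card_filter_comp_algebraMap_eq', hd]
  obtain ⟨σ₁, σ₂, hne, hS⟩ := Finset.card_eq_two.mp hcard
  have h₁ : σ₁ ∈ Finset.univ.filter (fun σ' : L →+* ℂ => σ'.comp (algebraMap K L) = σ) := by
    rw [hS]; exact Finset.mem_insert_self _ _
  have h₂ : σ₂ ∈ Finset.univ.filter (fun σ' : L →+* ℂ => σ'.comp (algebraMap K L) = σ) := by
    rw [hS]; exact Finset.mem_insert_of_mem (Finset.mem_singleton_self _)
  refine ⟨σ₁, σ₂, hne, (Finset.mem_filter.mp h₁).2, (Finset.mem_filter.mp h₂).2, ?_⟩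
  rw [hS, Finset.sum_pair hne]

omit [NumberField K] in
/-- An infinity type whose multiset of `z`-exponents at some embedding is a "double" `M + M`
(`M ≠ 0`) is not regular (Clozel, Déf. 3.12: regular = pairwise distinct exponents). This is how
Henniart's identity obstructs regularity of an automorphic induction from a quadratic extension
whose inducing datum has the same exponents at the two extensions of `σ`. [cite: Clozel1990, Définition 3.12] -/
theorem InfinityType.not_isRegular_of_map_a_eq_add_self {N : ℕ} {T : InfinityType K N}
    {σ : K →+* ℂ} {M : Multiset ℂ} (hM : M ≠ 0) (h : (T σ).map ArchWeight.a = M + M) :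
    ¬ T.IsRegular := by
  intro hreg
  have hnd : (M + M).Nodup := h ▸ hreg σ
  obtain ⟨x, hx⟩ := Multiset.exists_mem_of_ne_zero hM
  exact Multiset.disjoint_left.mp (Multiset.nodup_add.mp hnd).2.2 hx hx

end Quadratic

end Literature.NumberTheory.Automorphic
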